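import Mathlib
import HarnessLib
import HarnessLib.Audit
import Summits.Schanuel.Statement
import HarnessLib.Audit.Status.Attr

/-!
Route: BakerOverExpField

# Route BakerOverExpField — Baker over the exponential field — n+1 ≤ dim_L span(1,z) + trdeg ℚ(e^z),
plus an affine-to-algebraic residual

X = X1 ∧ X2 (conjunct split of Schanuel, typed from sketch baker-over-exponential-field). For
ℚ-linearly independent
z ∈ ℂⁿ put K = ℚ(e^{z₁},…,e^{zₙ}), b = trdeg_ℚ K, L = algebraicClosure K ℂ (the algebraic closure of
K inside ℂ),
d = dim_L span_L{1, z₁,…,zₙ}, F = ℚ(z, e^z). X1 = BakerOverL (ATTACKED): n + 1 ≤ d + b — the ℚ-span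
of 1, z₁,…,zₙ loses
at most b dimensions when the coefficient field is enlarged from ℚ̄ to L; its b = 0 layer is exactly
Baker's theorem
(proved in tree). X2 = AffineToAlgebraic (declared RESIDUAL): Schanuel(z) ∨ d + b ≤ trdeg_ℚ F + 1 —
L-affine independence
of the zᵢ upgrades to algebraic independence over L. X1 ∧ X2 → S is two lines of cardinal
arithmetic; S → X1 and S → X2
hold by the tower law resp. trivially, so X1 ∧ X2 ⟺ S and the route names X1 as the conjunct it
attacks.
Lean: `(∀ (n : ℕ) (z : Fin n → ℂ), LinearIndependent ℚ z → ((n + 1 : ℕ) : Cardinal) ≤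
(Module.finrank (algebraicClosure (IntermediateField.adjoin ℚ (Set.range (Complex.exp ∘ z))) ℂ)
(Submodule.span (algebraicClosure (IntermediateField.adjoin ℚ (Set.range (Complex.exp ∘ z))) ℂ)
(insert (1 : ℂ) (Set.range z))) : Cardinal) + Algebra.trdeg ℚ (IntermediateField.adjoin ℚ (Set.range
(Complex.exp ∘ z)))) ∧ (∀ (n : ℕ) (z : Fin n → ℂ), LinearIndependent ℚ z → (n : Cardinal) ≤
Algebra.trdeg ℚ (IntermediateField.adjoin ℚ (Set.range z ∪ Set.range (Complex.exp ∘ z))) ∨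
(Module.finrank (algebraicClosure (IntermediateField.adjoin ℚ (Set.range (Complex.exp ∘ z))) ℂ)
(Submodule.span (algebraicClosure (IntermediateField.adjoin ℚ (Set.range (Complex.exp ∘ z))) ℂ)
(insert (1 : ℂ) (Set.range z))) : Cardinal) + Algebra.trdeg ℚ (IntermediateField.adjoin ℚ (Set.range
(Complex.exp ∘ z))) ≤ Algebra.trdeg ℚ (IntermediateField.adjoin ℚ (Set.range z ∪ Set.range
(Complex.exp ∘ z))) + 1)`

## Assembly
Pure cardinal arithmetic, kernel-checked (Sketch.lean / glue.lean `closes`, axioms propext,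
Classical.choice, Quot.sound): fix n, z, hz;
X2 gives Schanuel(z) outright or d + b ≤ trdeg_ℚ F + 1; in the second case X1 gives n + 1 ≤ d + b ≤
trdeg_ℚ F + 1 and
`Order.add_one_le_iff`/`Cardinal.nat_succ` cancel the +1 (trdeg F may be an infinite cardinal a
priori; the lemma
`natCast_le_of_succ_le_add_one` handles both cases). The deciding theorem `closes : BakerOverL →
AffineToAlgebraic → Schanuel` is the glue; the Assembly item below is the type of `closes` itself.

Rationale: WHY THIS LINE. Mechanism: move the coefficient field of Baker's theorem from ℚ̄ to L = algebraic
closure of the field generated by the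
exponentials, and pay for it with exactly trdeg_ℚ ℚ(e^z) dimensions; this grades Schanuel by b and
makes every layer
b = k a LINEAR-independence statement of Baker's own output shape (Baker1975 Thm 2.1; Chudnovsky1984
ch. 2, Baker's method
over a coefficient field K of transcendence type ≤ τ, Thm 1.1 p.138 and Thm 3.1 p.153 being the
nearest printed theorems of
this shape). Imported: transcendence theory only (Baker/Gelfond–Schneider in several variables,
criteria for algebraic
independence NesterenkoPhilippon2001 Ch. 14); no cross-field dictionary is claimed. What it does
that existing routes do
not: LogPatterns stakes everything on AIL (LogSector) and DiophantineCore on the Technical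
Hypothesis (a MEASURE of
ℚ-linear independence); here the attacked conjunct X1 is strictly weaker than Schanuel (S ⇒ X1 by
the tower law, X1 is
blind to algebraic relations among logarithms and to membership z ⊂ L), has a proved first rung (b =
0 = Baker, landed as
Literature.NumberTheory.Transcendental.baker_expField_logLayer, p172059) and a next rung (b = 1)
that already contains
e ⊥ π at (1, iπ) and e^e ∉ ℚ̄ at (1, e) as linear statements over ℚ(π)^alg resp. ℚ(e)^alg; the
nonlinear remainder
(AIL ∖ Baker, four exponentials) is isolated verbatim in the residual X2. Negatives index
(PolarPhantoms ×2) untouched.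

RANKED CRUXES. #2 BakerOverL (crux) — for every n and every ℚ-linearly independent z : Fin n → ℂ, n
+ 1 ≤ dim_L span_L(1, z₁,…,zₙ) + trdeg_ℚ ℚ(e^z), where L is the algebraic closure in ℂ of
ℚ(e^{z₁},…,e^{zₙ}) (sketch X1; layers X1_b by b = trdeg; X1_0 = Baker, proved). [difficulty:
open-problem] (why it might fail: false only if Schanuel is, but the b ≥ 1 layers contain e⊥π at
(1,iπ) and e^e∉ℚ̄ at (1,e); Baker/Gelfond–Schneider machinery needs heights or a transcendence type
on the coefficient field and an M×N grid of exponentials (Chudnovsky1984 Thm 3.1), absent for one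
exponential per coordinate.) [Baker1975, Chudnovsky1984, NesterenkoPhilippon2001, Diaz1989,
Waldschmidt2000]
#3 AffineToAlgebraic (crux) — RESIDUAL conjunct (imported, not attacked): for every ℚ-linearly
independent z, either Schanuel's inequality holds at z or dim_L span_L(1, z) + trdeg_ℚ ℚ(e^z) ≤
trdeg_ℚ ℚ(z, e^z) + 1 (L-affine independence of the zᵢ upgrades to algebraic independence; its b = 0
layer is algebraic independence of logarithms beyond Baker). [difficulty: open-problem] (why it
might fail: false only if Schanuel is; its b = 0 layer is AIL beyond Baker (two algebraically
independent logarithms unknown; Barrier AlgebraicIndependenceOfLogarithms), at (1, iπ, log 2) it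
yields four exponentials, and no method outputs nonlinear independence of logarithms — hence
declared residual.) [Waldschmidt2000, Roy1995, NesterenkoPhilippon2001, Baker1975]

TWO-LAYER PLAN. BakerOverL ⇐ HomogeneousLossyBaker → InhomogeneousStep → BakerOverL (registered
birth skeleton Lines/birth.lean: n ≤ dim_L span_L(z) + b,
then 1 ∉ span_L(z) in the extremal case; glue proved). Foreseen rung ladder inside
HomogeneousLossyBaker: b = 0 (Baker, proved:
baker_expField_logLayer), b = 1 (X1_1 ⊇ e⊥π, e^e; first target: coefficient field ℚ(θ)^alg with θ =
the one transcendental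
exponential, Chudnovsky1984 ch.2 'trdeg K ≤ 1' technology), general b. AffineToAlgebraic ⇐ LogSector
(= LogPatterns.LogSector
verbatim, shared) → TranscendentalLayer → AffineToAlgebraic (birth skeleton, glue proved) —
residual, not staffed from here.

KILL CRITERIA. Both cruxes are implied by Schanuel, so a refutation of either is a disproof of
Schanuel (close refuted:<Decl> and hand the witness
to the summit). The route is retired (superseded) if LogPatterns closes LogSector AND a direct
F-level argument lands, or if a
refuter shows X1_1 (the b = 1 layer) is equivalent to full Gelfond–Schneider-type algebraic
independence with no linear gain —
then the grading by b buys nothing and the line is a costume of S. Pivot: if HomogeneousLossyBaker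
stalls at b = 1 for a year of
seats, re-target to the Gelfond-tower sector z = log α·(1, β,…,β^(d−1)) where X1 = Gelfond's
conjecture (Diaz ladder).

NOT DECOMPOSED YET. The b = 1 layer as its own item (needs the coefficient field ℚ(θ)^alg
bookkeeping; filed as a stub, not an item); Gelfond-tower
and exponential-sector special cases; any measure / transcendence-type hypothesis (that is
DiophantineCore's business); the n ≤ 2
bookkeeping S1–S3 of the sketch (provable-now, ride as --supports lemmas); nothing of X2 beyond its
birth skeleton (residual).

CHEAPEST FALSIFIER. Lookup + one in-Lean check, both run: (i) is X1 with b ≥ 1 already refuted or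
known under another name? lit search --hybrid / vsearch
(chudnovsky1984 pp.138,153; nesterenko2001 pp.248–249) and galaxy (panama LNM 1290, LNM 1415, Zhu)
show only CONDITIONAL (transcendence
type / T.H.) versions — no refutation, no unconditional b ≥ 1 theorem; (ii) BC7 crux probe: both
cruxes VERDICT CLEAN (no cheap proof,
no vacuity, C → S fails by exact?/aesop/simpa). The cheapest mathematical kill is the refuter
exercise "X1_1 at (1, iπ) ⟺ e⊥π":
if X1_1 turns out provably EQUIVALENT to the full b = 1 case of Schanuel, the grading is void (route
→ costume verdict).

NUMBERS. b = 0: d = n + 1 (Baker1975 Thm 2.1; tree bakerFin_holds, baker_expField_logLayer). Grid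
theorems over K with trdeg K ≤ 1:
MN ≥ M + N + r₂N ⇒ αᵢ, e^(αᵢβⱼ) not all in K (Chudnovsky1984 Thm 3.1 p.153); {α₁,α₂}×{β₁..β₄} (Thm
1.1 p.138). Gelfond towers:
trdeg ℚ(α^β,…,α^(β^(d−1))) ≥ [(d+1)/2] (Diaz1989; NesterenkoPhilippon2001 Ch.14 Cor 2.8 p.249),
small-trdeg frontier Thm 2.9 p.249.
Items at open: 2.

DEFINITION REQUESTS. None: algebraicClosure (IntermediateField), IntermediateField.adjoin,
Algebra.trdeg, Module.finrank, Submodule.span are Mathlib;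
the BC5 rung is proposed as Literature.NumberTheory.Transcendental.baker_expField_logLayer
(p172059).

Novelty: Searches (2026-08-17): lit search --hybrid "Baker theorem linear forms logarithms transcendental
coefficients field generated exponentials" (held: chudnovsky1984 p.138/153, baker1975, baker1988
p.151, wustholz1987 LNM1290, nesterenko2001); lit vsearch "<X1 in prose>" -k 8 (chudnovsky1984
pp.153,138,92,35; nesterenko2001 pp.165,233,248; pila2022 pp.105,107 — none states X1); lit galaxy
search "Baker's method|linear forms in logarithms|algebraic independence of logarithms" --star all
(panama:513334491218017 LNM1290, panama:332207130411093 New Advances in Transcendence Theory,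
pdf:1090623440 Waldschmidt auxiliary functions, panama:497898378756174 Zhu); lit galaxy search
"transcendence type|type de transcendance" --star panama (panama:433173221605438 LNM1415,
panama:518247933804574 Zhu basic theory, panama:513334491218017); two in-book galaxy queries timed
out (queue > 90 s); lean search / Theses grep: no tree decl over algebraicClosure (adjoin ℚ (range
(cexp ∘ z))) ℂ; ledger idea list: nearest cards baker-for-exponential-algebraic-numbers (→
DiophantineCore, T.H. measures) and period-lattice-rigidity-baker (→ RigidCore).
Nearest prior art found: Chudnovsky1984 ch.2 (Baker's method over a coefficient field of
transcendence type ≤ τ: Thm 1.1 p.138, Thm 3.1 p.153 — conditional on a transcendence type and on an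
M×N grid); Waldschmidt2000 / Roy1995 (linear-subgroup reformulations over ℚ̄); in tree: route
LogPatterns (LogSector = AIL deciding) and DiophantineCore (Technical Hypothesis  [refs: Chudnovsky1984, Waldschmidt2000, Roy1995]

Barriers (technique_class: baker-over-exp-field, gelfond-schneider-several-var): - technique_class: baker-over-exp-field, gelfond-schneider-several-var
- Literature.Barriers.Schanuel.AlgebraicIndependenceOfLogarithms: BakerOverL sits INSIDE the
linear-independence output class on purpose — it is the part of S statable as linear independence
(over L), and the barrier's content (AIL ∖ Baker is not linear over ℚ̄) is exactly what is exported
to the residual AffineToAlgebraic; the bet is that linear independence over the LARGER field L is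
still within reach of Baker-type auxiliary functions layer by layer in b
[corpus:book:chudnovsky1984-contributions-theory-transcendental-numbers p.138].
- Literature.Barriers.Schanuel.LargeTranscendenceDegree: on Gelfond towers z = log α·(1,β,…,β^(d−1))
BakerOverL restricts to Gelfond's conjecture, reached unconditionally only to [(d+1)/2] (Diaz1989)
[corpus:book:nesterenko2001-introduction-algebraic-independence-theory p.249]; the route does not
beat this head-on at open: its ladder starts at b = 1 with n = 2 (e⊥π-type statements), below the
barrier's regime d ≥ 3, and names the barrier's own escapes (T.H.-free zero estimates, sharper
estimates for algebraic xᵢ) for the tower sector, shared with AlgIndepMethod items.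
- Literature.Barriers.Schanuel.LinearSubgroupMethodLimit: Roy's limit concerns ℚ̄-linear
algebraic-subgroup statements equivalent to S; BakerOverL is NOT equivalent to S (the
quadratic/four-exponential content is in the residual), so the limit theorem does not quantify over
it; AffineToAlgebraic is inside and d

sub-problem: Schanuel · status: open · opened planner-type-af4c081939-0 2026-08-17T18:27:55Z · rev 0 · ledger route-Schanuel-BakerOverExpField
GENERATED by the gate from the ledger (D-0016/17). Provers cite these decls: `theorem foo : Summit.Schanuel.Schanuel.Theses.BakerOverExpField.<Decl> := …` in Summits/Schanuel/Schanuel/Theorems/<Name>.lean.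
-/

namespace Summit.Schanuel.Schanuel.Theses.BakerOverExpField

open scoped BigOperators Topology Manifold Classical MeasureTheory ProbabilityTheory Matrix InnerProductSpace ComplexConjugate ContinuousMap
open Filter Set Function TopologicalSpace MeasureTheory

attribute [summit_statement] _root_.Schanuel

open Literature.Periods

/-- item stmt-Schanuel-19261 · crux · rank 2 · open · by planner
why it might fail: false only if Schanuel is, but the b ≥ 1 layers contain e⊥π at (1,iπ) and e^e∉ℚ̄ at (1,e); Baker/Gelfond–Schneider machinery needs heights or a transcendence type on the coefficient field and an M×N grid of exponentials (Chudnovsky1984 Thm 3.1), absent for one exponential per coordinate.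
sources: Baker1975, Chudnovsky1984, NesterenkoPhilippon2001, Diaz1989, Waldschmidt2000
[crux] for every n and every ℚ-linearly independent z : Fin n → ℂ, n + 1 ≤ dim_L span_L(1, z₁,…,zₙ)
+ trdeg_ℚ ℚ(e^z), where L is the algebraic closure in ℂ of ℚ(e^{z₁},…,e^{zₙ}) (sketch X1; layers
X1_b by b = trdeg; X1_0 = Baker, proved). [difficulty: open-problem] -/
@[route_item "route-Schanuel-BakerOverExpField", crux]
def BakerOverL : Prop :=
  ∀ (n : ℕ) (z : Fin n → ℂ), LinearIndependent ℚ z → ((n + 1 : ℕ) : Cardinal) ≤ (Module.finrank (algebraicClosure (IntermediateField.adjoin ℚ (Set.range (Complex.exp ∘ z))) ℂ) (Submodule.span (algebraicClosure (IntermediateField.adjoin ℚ (Set.range (Complex.exp ∘ z))) ℂ) (insert (1 : ℂ) (Set.range z))) : Cardinal) + Algebra.trdeg ℚ (IntermediateField.adjoin ℚ (Set.range (Complex.exp ∘ z)))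

/-- item stmt-Schanuel-19262 · crux · rank 3 · open · by planner
why it might fail: false only if Schanuel is; its b = 0 layer is AIL beyond Baker (two algebraically independent logarithms unknown; Barrier AlgebraicIndependenceOfLogarithms), at (1, iπ, log 2) it yields four exponentials, and no method outputs nonlinear independence of logarithms — hence declared residual.
sources: Waldschmidt2000, Roy1995, NesterenkoPhilippon2001, Baker1975
[crux] RESIDUAL conjunct (imported, not attacked): for every ℚ-linearly independent z, either
Schanuel's inequality holds at z or dim_L span_L(1, z) + trdeg_ℚ ℚ(e^z) ≤ trdeg_ℚ ℚ(z, e^z) + 1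
(L-affine independence of the zᵢ upgrades to algebraic independence; its b = 0 layer is algebraic
independence of logarithms beyond Baker). [difficulty: open-problem] -/
@[route_item "route-Schanuel-BakerOverExpField", crux]
def AffineToAlgebraic : Prop :=
  ∀ (n : ℕ) (z : Fin n → ℂ), LinearIndependent ℚ z → (n : Cardinal) ≤ Algebra.trdeg ℚ (IntermediateField.adjoin ℚ (Set.range z ∪ Set.range (Complex.exp ∘ z))) ∨ (Module.finrank (algebraicClosure (IntermediateField.adjoin ℚ (Set.range (Complex.exp ∘ z))) ℂ) (Submodule.span (algebraicClosure (IntermediateField.adjoin ℚ (Set.range (Complex.exp ∘ z))) ℂ) (insert (1 : ℂ) (Set.range z))) : Cardinal) + Algebra.trdeg ℚ (IntermediateField.adjoin ℚ (Set.range (Complex.exp ∘ z))) ≤ Algebra.trdeg ℚ (IntermediateField.adjoin ℚ (Set.range z ∪ Set.range (Complex.exp ∘ z))) + 1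

/-- item stmt-Schanuel-19263 · assembly · rank 1 · open · by planner
sources: Baker1975, Waldschmidt2000
[assembly] BakerOverL → AffineToAlgebraic → Schanuel (sub-problem statement `_root_.Schanuel`). -/
@[route_item "route-Schanuel-BakerOverExpField"]
def Assembly : Prop :=
  BakerOverL → AffineToAlgebraic → _root_.Schanuel

/-! D-0027 §2.1 — DECIDING THEOREM (planner-authored via `route open/edit --closes-file`; by planner-type-af4c081939-0 2026-08-17T18:27:55Z):
its hypotheses are this route's items and its conclusion the sub-problem Statement (glue_lint), and it elaborates with this file. -/

/-- DECIDING THEOREM (D-0027 §2.1): `BakerOverL → AffineToAlgebraic → Schanuel`.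
Fix `n, z, hz`. `AffineToAlgebraic` gives Schanuel's inequality at `z` outright, or
`d + b ≤ trdeg ℚ ℚ(z, e^z) + 1`; in the second case `BakerOverL` gives `n + 1 ≤ d + b`, and the
`+ 1` cancels in `Cardinal` (finite case by `Nat` arithmetic, infinite case trivially). -/
@[closes "route-Schanuel-BakerOverExpField"] theorem closes (h₁ : BakerOverL) (h₂ : AffineToAlgebraic) : _root_.Schanuel := by
  -- cardinal cancellation `n + 1 ≤ T + 1 → n ≤ T`
  have cancel : ∀ {n : ℕ} {T : Cardinal.{0}},
      ((n + 1 : ℕ) : Cardinal.{0}) ≤ T + 1 → (n : Cardinal.{0}) ≤ T := by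
    intro n T h
    rcases lt_or_ge T Cardinal.aleph0 with hT | hT
    · obtain ⟨m, rfl⟩ := Cardinal.lt_aleph0.1 hT
      have h' : ((n + 1 : ℕ) : Cardinal.{0}) ≤ ((m + 1 : ℕ) : Cardinal.{0}) := by
        simpa [Nat.cast_add, Nat.cast_one] using h
      have : n + 1 ≤ m + 1 := by exact_mod_cast h'
      exact_mod_cast (Nat.le_of_succ_le_succ this)
    · exact ((Cardinal.natCast_lt_aleph0 (n := n)).le).trans hT
  unfold Schanuel Literature.Periods.SchanuelConjecture
  intro n z hz
  rcases h₂ n z hz with h | h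
  · exact h
  · exact cancel ((h₁ n z hz).trans h)

end Summit.Schanuel.Schanuel.Theses.BakerOverExpField
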